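import Summits.BirchSwinnertonDyer.Rank1Residual.X11b.AnticyclotomicSelmer
import Literature.NumberTheory.EllipticCurves.GreenbergVatsal2000.GreenbergSelmerGroups
import Literature.NumberTheory.EllipticCurves.FineSelmerCoefficientMapProofs
import HarnessLib

/-!
# Route UniversalToricDescent — the RESIDUAL anticyclotomic Selmer group of a finite Galois module and
# its transport along a `Γ_K`-equivariant isomorphism of coefficients (port-grade algebraic half of
# child 20399 / `InvariantsTransportModThreeT`, step "`R(E[3]) ≅ R(E′[3])`")

Lead prover bsd-wall-utd-p1 g6 (`--supports stmt-BirchSwinnertonDyer-20399`; PRICING-20399-ALG-HALF-utdp1g5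
§2 (X) / §8 brick (ii), companion of `UniversalToricDescentAcDualMuZeroCriterion`). The residual comparison
behind the Greenberg–Vatsal transport «`X_{∅,0}(E′/K_∞)` torsion with `μ = 0` ⟹ the same for `E`» compares
the `p`-torsion of Castella's Selmer groups of `E[p^∞]`, `E′[p^∞]` through ONE group attached to the FINITE
module `M = E[p] ≅ E′[p]`. In the anticyclotomic tower the good primes inert in `K` split completely, so
the residual local condition induced from `E[p^∞]` at a good place is «UNRAMIFIED» (not «locally
trivial», PRICING §1 TYPING CAVEAT / §8 (3)); the residual object is therefore the EXISTING Literature group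

  `R_𝔭^Σ(L, M) := GreenbergVatsal2000.datumStrictSelmer H M p (AcSelmer.bdpData M p 𝔭) Σ ⊆ H¹(H, M)`,

`L = K̄^H`: classes which, after every conjugation `conj_σ`, are unramified at each finite `v ∉ Σ`,
`v ∤ p` and satisfy Castella's STRICT condition at `𝔭` (relaxed at the other places above `p`; no condition
on `Σ`; no archimedean condition — vacuous for odd `p`). No new definition is introduced.

* §1 functoriality of the two local conditions in the coefficients: a `Γ_K`-equivariant additive map
  `ψ : M → M′` induces `ψ_* : H¹(H, M) → H¹(H, M′)` commuting with restriction to `H ⊓ I_v`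
  (`res_inertiaIn_comp_resH1Hom_id`), hence preserving `unramifiedKer` (`resH1Hom_id_mem_unramifiedKer`)
  and Castella's strict condition at `𝔭` (`resH1Hom_id_mem_strictKer_strictDatum`, via the tree's
  criterion `mem_strictKer_fineLocalDatum_iff` — Castella's `strictDatum` IS the fine datum `M⁺ = 0`).
* §2 `resH1Hom_id_mem_residualSelmer`: `ψ_*` maps `R_𝔭^Σ(L, M)` into `R_𝔭^Σ(L, M′)` (conjugation commutes
  with `ψ_*`, tree `conjH1_comp_resH1Hom_id`); **`finite_residualSelmer_iff_of_addEquiv`**: for a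
  `Γ_K`-equivariant additive ISOMORPHISM `ψ : M ≃ M′`, `R_𝔭^Σ(L, M)` is finite iff `R_𝔭^Σ(L, M′)` is — the
  transport step of the residual comparison (Greenberg–Vatsal p. 26 "`E₁[p] ≅ E₂[p]` as Galois modules …
  the Selmer groups for `E₁[p]` and `E₂[p]` … are then isomorphic"; Lim–Sujatha Prop. 3.2's
  `R_S(A[π]) ≅ R_S(B[π])`), here for Castella's anticyclotomic conditions. Pattern of the tree's
  `FineSelmerCoefficientMap.finite_fineSelmerInfty_iff_of_addEquiv` (fine Selmer group, cyclotomic use).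
* §3 the elliptic-curve instance: for `W₁, W₂` over `K` with a `Γ_K`-equivariant `W₁[p] ≃+ W₂[p]` (the
  route's `ModPCongruent` after base change), `R_𝔭^Σ(K_∞, W₁[p])` finite ⟺ `R_𝔭^Σ(K_∞, W₂[p])` finite
  (`finite_residualSelmer_geomTorsion_iff_of_torsionIso`).

THEOREMS ONLY; no definition, no named fact, no `sorry`; imports no `Theses` module. BSD is not advanced by
this file. References: [GreenbergVatsal2000] §2 p. 26 (two-curve argument); [LimSujatha2018] §3 Prop. 3.2
(proof); [Castella2018] Def. 2.2; [Greenberg1989] §1 p. 98; [SerreGaloisCohomology1997] I.§2.4–2.5, I.§5.1.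
-/

set_option autoImplicit false
-- `…BirchSwinnertonDyer.BirchSwinnertonDyer.Theorems…` is the problem's mandated namespace (D-0017).
set_option linter.dupNamespace false

noncomputable section

open scoped Classical

universe u

namespace Summit.BirchSwinnertonDyer.BirchSwinnertonDyer.Theorems.UniversalToricDescentResidualSelmer

open NumberField IsDedekindDomain Field
open Literature.NumberTheory.EllipticCurves Literature.NumberTheory.EllipticCurves.GreenbergSelmer
  Literature.NumberTheory.EllipticCurves.GreenbergVatsal2000
  Literature.NumberTheory.EllipticCurves.FineSelmerCoefficientMap
  Literature.NumberTheory.GaloisRepresentations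
  Summit.BirchSwinnertonDyer.Rank1Residual.X11b Summit.BirchSwinnertonDyer.Rank1Residual.X11b.AcSelmer

variable {K : Type u} [Field K] [NumberField K]
variable {M : Type u} [AddCommGroup M] [DistribMulAction (absoluteGaloisGroup K) M]
  [TopologicalSpace M] [DiscreteTopology M]
variable {M' : Type u} [AddCommGroup M'] [DistribMulAction (absoluteGaloisGroup K) M']
  [TopologicalSpace M'] [DiscreteTopology M']

/-! ### §1 The two local conditions under a map of coefficients -/

section Local

variable (H : Subgroup (absoluteGaloisGroup K))

/-- **`ψ_*` commutes with restriction to the inertia group `H ⊓ I_v`** (both composites are induced by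
the compatible pair `(H ⊓ I_v ↪ H, ψ)`, `resH1Hom_comp`). [cite: SerreGaloisCohomology1997, I.§2.4] -/
theorem res_inertiaIn_comp_resH1Hom_id (v : HeightOneSpectrum (𝓞 K)) (ψ : M →+ M')
    (hψH : ∀ (x : H) (m : M), ψ (ContinuousMonoidHom.id H x • m) = x • ψ m)
    (hψI : ∀ (x : inertiaIn H v) (m : M),
      ψ (ContinuousMonoidHom.id (inertiaIn H v) x • m) = x • ψ m) :
    (resH1Hom (inertiaInToH H v) (AddMonoidHom.id M') fun _ _ ↦ rfl).comp
        (resH1Hom (ContinuousMonoidHom.id H) ψ hψH) =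
      (resH1Hom (ContinuousMonoidHom.id (inertiaIn H v)) ψ hψI).comp
        (resH1Hom (inertiaInToH H v) (AddMonoidHom.id M) fun _ _ ↦ rfl) := by
  rw [resH1Hom_comp, resH1Hom_comp]
  exact resH1Hom_congr (ContinuousMonoidHom.ext fun _ ↦ rfl) (AddMonoidHom.ext fun _ ↦ rfl) _ _

/-- **A `Γ_K`-equivariant map of coefficients preserves the unramified condition at `v`**: if
`c ∈ H¹(H, M)` dies on `H ⊓ I_v` then so does `ψ_* c ∈ H¹(H, M′)`. [cite: GreenbergVatsal2000, §2 p. 17] -/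
theorem resH1Hom_id_mem_unramifiedKer (v : HeightOneSpectrum (𝓞 K)) (ψ : M →+ M')
    (hψ' : ∀ (g : absoluteGaloisGroup K) (m : M), ψ (g • m) = g • ψ m)
    (hψH : ∀ (x : H) (m : M), ψ (ContinuousMonoidHom.id H x • m) = x • ψ m)
    {c : subgroupH1 H M} (hc : c ∈ unramifiedKer H M v) :
    resH1Hom (ContinuousMonoidHom.id H) ψ hψH c ∈ unramifiedKer H M' v := by
  rw [GreenbergVatsal2000.unramifiedKer, AddMonoidHom.mem_ker] at hc ⊢
  have e := congrArg (fun f : subgroupH1 H M →+ discreteH1 (inertiaIn H v) M' ↦ f c)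
    (res_inertiaIn_comp_resH1Hom_id H v ψ hψH (fun x m ↦ hψ' _ m))
  simp only [AddMonoidHom.comp_apply] at e
  rw [e, hc, map_zero]

omit [TopologicalSpace M] [DiscreteTopology M] in
/-- Castella's strict datum `M⁺_𝔭 = 0` IS the tree's fine local datum (same fields). [cite: Castella2018, §2.1 Def. 2.1–2.2 (arXiv:1704.06608 p. 5)] -/
theorem strictDatum_eq_fineLocalDatum (v : HeightOneSpectrum (𝓞 K)) :
    AcSelmer.strictDatum M v = fineLocalDatum M v :=
  rfl

/-- Castella's STRICT condition at `v` is "the restriction to `H ⊓ D_v` vanishes" (the tree's criterion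
for the fine datum, `mem_strictKer_fineLocalDatum_iff`). [cite: Greenberg1989, §1 p. 98 (the strict condition)] -/
theorem mem_strictKer_strictDatum_iff (v : HeightOneSpectrum (𝓞 K)) (c : subgroupH1 H M) :
    c ∈ (AcSelmer.strictDatum M v).strictKer H ↔
      resOfLe M (inf_le_left : H ⊓ decomp v ≤ H) c = 0 := by
  rw [strictDatum_eq_fineLocalDatum]
  exact mem_strictKer_fineLocalDatum_iff H v c

/-- **A `Γ_K`-equivariant map of coefficients preserves Castella's strict condition at `v`** (`ψ_*`
commutes with restriction to `H ⊓ D_v`, tree `resOfLe_comp_resH1Hom_id`). [cite: Greenberg1989, §1 p. 98] -/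
theorem resH1Hom_id_mem_strictKer_strictDatum (v : HeightOneSpectrum (𝓞 K)) (ψ : M →+ M')
    (hψ' : ∀ (g : absoluteGaloisGroup K) (m : M), ψ (g • m) = g • ψ m)
    (hψH : ∀ (x : H) (m : M), ψ (ContinuousMonoidHom.id H x • m) = x • ψ m)
    {c : subgroupH1 H M} (hc : c ∈ (AcSelmer.strictDatum M v).strictKer H) :
    resH1Hom (ContinuousMonoidHom.id H) ψ hψH c ∈ (AcSelmer.strictDatum M' v).strictKer H := by
  rw [mem_strictKer_strictDatum_iff] at hc ⊢
  have e := congrArg (fun f : subgroupH1 H M →+ subgroupH1 (H ⊓ decomp v) M' ↦ f c)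
    (resOfLe_comp_resH1Hom_id (inf_le_left : H ⊓ decomp v ≤ H) ψ hψH (fun x m ↦ hψ' x m))
  simp only [AddMonoidHom.comp_apply] at e
  rw [e, hc, map_zero]

end Local

/-! ### §2 The residual anticyclotomic Selmer group under a map / an isomorphism of coefficients -/

section Residual

variable (H : Subgroup (absoluteGaloisGroup K)) [H.Normal] (p : ℕ) (𝔭 : HeightOneSpectrum (𝓞 K))
  (S₀ : Set (HeightOneSpectrum (𝓞 K)))

/-- **`ψ_*` maps `R_𝔭^Σ(L, M)` into `R_𝔭^Σ(L, M′)`** for a `Γ_K`-equivariant `ψ : M → M′`: every defining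
condition is "a conjugate lies in a local kernel", `ψ_*` commutes with conjugation
(`conjH1_comp_resH1Hom_id`) and preserves both local kernels (§1); at the places `v ∣ p`, `v ≠ 𝔭` the
datum is relaxed and the condition vacuous (`strictKer_relaxedDatum_eq_top`).
[cite: GreenbergVatsal2000, §2 p. 26] [cite: LimSujatha2018, §3 (functoriality of `R_S(·/𝓛)`)] -/
theorem resH1Hom_id_mem_residualSelmer (ψ : M →+ M')
    (hψ' : ∀ (g : absoluteGaloisGroup K) (m : M), ψ (g • m) = g • ψ m)
    (hψH : ∀ (x : H) (m : M), ψ (ContinuousMonoidHom.id H x • m) = x • ψ m)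
    {c : subgroupH1 H M} (hc : c ∈ datumStrictSelmer H M p (AcSelmer.bdpData M p 𝔭) S₀) :
    resH1Hom (ContinuousMonoidHom.id H) ψ hψH c ∈
      datumStrictSelmer H M' p (AcSelmer.bdpData M' p 𝔭) S₀ := by
  rw [mem_datumStrictSelmer_iff, mem_unramifiedOutside_iff] at hc ⊢
  have hconj : ∀ σ : absoluteGaloisGroup K,
      conjH1 H M' σ (resH1Hom (ContinuousMonoidHom.id H) ψ hψH c) =
        resH1Hom (ContinuousMonoidHom.id H) ψ hψH (conjH1 H M σ c) :=
    fun σ ↦ congrArg (fun f : subgroupH1 H M →+ subgroupH1 H M' ↦ f c)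
      (conjH1_comp_resH1Hom_id H ψ hψH hψ' σ)
  refine ⟨fun v hvS hvp σ ↦ ?_, fun v hv σ ↦ ?_⟩
  · rw [hconj]
    exact resH1Hom_id_mem_unramifiedKer H v ψ hψ' hψH (hc.1 v hvS hvp σ)
  · rw [hconj]
    by_cases hv𝔭 : v = 𝔭
    · subst hv𝔭
      have h := hc.2 v hv σ
      rw [AcSelmer.bdpData_self p v hv] at h ⊢
      exact resH1Hom_id_mem_strictKer_strictDatum H v ψ hψ' hψH h
    · rw [AcSelmer.bdpData_of_ne p 𝔭 hv hv𝔭, AcSelmer.strictKer_relaxedDatum_eq_top]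
      exact AddSubgroup.mem_top _

/-- **Transport of the residual anticyclotomic Selmer group along an equivariant isomorphism of
coefficients.** For a `Γ_K`-equivariant additive isomorphism `ψ : M ≃ M′`, `ψ_*` restricts to a bijection
`R_𝔭^Σ(L, M) ≃ R_𝔭^Σ(L, M′)`; in particular one is finite iff the other is. (Greenberg–Vatsal's
"`E₁[p] ≅ E₂[p]` … the Selmer groups are then isomorphic", p. 26, for Castella's anticyclotomic local
conditions; pattern of the tree's `finite_fineSelmerInfty_iff_of_addEquiv`.)
[cite: GreenbergVatsal2000, §2 p. 26] [cite: LimSujatha2018, §3 Prop. 3.2 (proof)] -/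
theorem finite_residualSelmer_iff_of_addEquiv (ψ : M ≃+ M')
    (hψ' : ∀ (g : absoluteGaloisGroup K) (m : M), ψ (g • m) = g • ψ m) :
    (datumStrictSelmer H M p (AcSelmer.bdpData M p 𝔭) S₀ : Set (subgroupH1 H M)).Finite ↔
      (datumStrictSelmer H M' p (AcSelmer.bdpData M' p 𝔭) S₀ : Set (subgroupH1 H M')).Finite := by
  have hψs' : ∀ (g : absoluteGaloisGroup K) (m : M'), ψ.symm (g • m) = g • ψ.symm m := fun g m ↦ by
    apply ψ.injective
    rw [ψ.apply_symm_apply, hψ', ψ.apply_symm_apply]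
  have hψ : ∀ (x : H) (m : M),
      (ψ : M →+ M') (ContinuousMonoidHom.id H x • m) = x • (ψ : M →+ M') m :=
    fun x m ↦ hψ' x m
  have hψs : ∀ (x : H) (m : M'),
      (ψ.symm : M' →+ M) (ContinuousMonoidHom.id H x • m) = x • (ψ.symm : M' →+ M) m :=
    fun x m ↦ hψs' x m
  set F := resH1Hom (ContinuousMonoidHom.id H) (ψ : M →+ M') hψ with hF
  set G := resH1Hom (ContinuousMonoidHom.id H) (ψ.symm : M' →+ M) hψs with hG
  have hGF : ∀ c, G (F c) = c := fun c ↦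
    congrArg (fun f : subgroupH1 H M →+ subgroupH1 H M ↦ f c) (resH1Hom_id_symm_comp H ψ hψ hψs)
  have hFG : ∀ c, F (G c) = c := fun c ↦ by
    have e := resH1Hom_id_symm_comp H ψ.symm hψs
      (fun x m ↦ by rw [AddEquiv.symm_symm]; exact hψ x m)
    have e' := congrArg (fun f : subgroupH1 H M' →+ subgroupH1 H M' ↦ f c) e
    simp only [AddMonoidHom.comp_apply, AddMonoidHom.id_apply] at e'
    rw [hF]
    convert e' using 2
    exact resH1Hom_congr rfl (by rw [AddEquiv.symm_symm]) _ _
  have hFmem : ∀ c ∈ datumStrictSelmer H M p (AcSelmer.bdpData M p 𝔭) S₀,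
      F c ∈ datumStrictSelmer H M' p (AcSelmer.bdpData M' p 𝔭) S₀ := fun c hc ↦
    resH1Hom_id_mem_residualSelmer H p 𝔭 S₀ (ψ : M →+ M') (fun g m ↦ hψ' g m) hψ hc
  have hGmem : ∀ c ∈ datumStrictSelmer H M' p (AcSelmer.bdpData M' p 𝔭) S₀,
      G c ∈ datumStrictSelmer H M p (AcSelmer.bdpData M p 𝔭) S₀ := fun c hc ↦
    resH1Hom_id_mem_residualSelmer H p 𝔭 S₀ (ψ.symm : M' →+ M) (fun g m ↦ hψs' g m) hψs hc
  constructor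
  · intro hfin
    exact (hfin.image F).subset fun c hc ↦ ⟨G c, hGmem c hc, hFG c⟩
  · intro hfin
    exact (hfin.image G).subset fun c hc ↦ ⟨F c, hFmem c hc, hGF c⟩

end Residual

/-! ### §3 The instance `M = E₁[p] ≅ E₂[p]` over the top of a `ℤ_p`-extension -/

section Curves

variable (W₁ W₂ : WeierstrassCurve K) {p : ℕ} [Fact p.Prime] (κ : ZpExtension K p)
  (𝔭 : HeightOneSpectrum (𝓞 K)) (S₀ : Set (HeightOneSpectrum (𝓞 K)))

/-- **`E₁[p] ≅ E₂[p]` as `Γ_K`-modules ⟹ `R_𝔭^Σ(K_∞, E₁[p])` is finite iff `R_𝔭^Σ(K_∞, E₂[p])` is**, for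
every `ℤ_p`-extension `K_∞ = K̄^{ker κ}`, every `𝔭` and every `Σ` — the transport step of the residual
Selmer comparison for two `p`-congruent elliptic curves over `K` (the route's twin `W′` and `W` after base
change to the Heegner field). [cite: GreenbergVatsal2000, §2 p. 26] -/
theorem finite_residualSelmer_geomTorsion_iff_of_torsionIso
    (e : WeierstrassCurve.geomTorsion W₁ (p : ℤ) ≃+ WeierstrassCurve.geomTorsion W₂ (p : ℤ))
    (he : ∀ (σ : absoluteGaloisGroup K) (P : WeierstrassCurve.geomTorsion W₁ (p : ℤ)),
      e (σ • P) = σ • e P) :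
    (datumStrictSelmer κ.kerSubgroup (WeierstrassCurve.geomTorsion W₁ (p : ℤ)) p
        (AcSelmer.bdpData _ p 𝔭) S₀ :
        Set (subgroupH1 κ.kerSubgroup (WeierstrassCurve.geomTorsion W₁ (p : ℤ)))).Finite ↔
      (datumStrictSelmer κ.kerSubgroup (WeierstrassCurve.geomTorsion W₂ (p : ℤ)) p
        (AcSelmer.bdpData _ p 𝔭) S₀ :
        Set (subgroupH1 κ.kerSubgroup (WeierstrassCurve.geomTorsion W₂ (p : ℤ)))).Finite :=
  finite_residualSelmer_iff_of_addEquiv κ.kerSubgroup p 𝔭 S₀ e he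

end Curves

end Summit.BirchSwinnertonDyer.BirchSwinnertonDyer.Theorems.UniversalToricDescentResidualSelmer

end
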